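import Mathlib
import HarnessLib
import Summits.Ventures.LatticeQCDFlow.Exactness.SUNMultiStepLeapfrogHMC
import Summits.Ventures.LatticeQCDFlow.Exactness.SUNLeapfrogHMCEngine

/-!
# The moments of the `SU(N)` momentum refresh law in general coordinates: `E‖p_l‖² = d/(2κ)`, `E‖p_l‖ ≤ √(d/(2κ))`, `E Σ_l‖p_l‖ ≤ |L|√(d/(2κ))`, `E (Σ_l‖p_l‖)² ≤ |L|²·d/(2κ)` for the kinetic term `κΣ_l‖p_l‖²` on ANY `d`-dimensional coordinate space — the Gaussian inputs of a MEAN acceptance bound on the `SU(N)` rung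

HONEST FRAMING: exact (Metropolis-corrected) sampling algorithms for lattice gauge theory;
figures of merit are autocorrelation/cost numbers at stated couplings and volumes; no
continuum-physics claim.

Venture `LatticeQCDFlow` (cell pub-lqcd), topic `Exactness`; FANOUT row 14 (`eng-flowhmc`, engine
`latflow.fthmc`, family B; the row's test column «acceptance vs step size» on the `SU(N)` rung of rows 21–26: the
pointwise energy-error law of `SUNLeapfrogEnergyError` is a polynomial in `‖p‖`, `Σ_l‖p_l‖`; averaging it over
the refresh needs exactly these moments).  The general-dimension twin of `SU2MomentumLawMoments` (`d = 3`:
`E‖p_l‖² = 3/(2κ)`, `E‖p_l‖ = 2/√(πκ) ≤ √(3/(2κ))`).  NEW WORK of the cell over the tree (row 9's `SUNLeapfrogHMC`: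
`sunMomentumWeight μ T = e^{−T}·μ^{⊗links}`, `sunMomentumLaw μ T = Z⁻¹·sunMomentumWeight μ T` for ANY additive Haar
measure `μ` on ANY finite-dimensional coordinate space `E` and any kinetic term `T`; `SUNLeapfrogHMCEngine`;
`StdGaussianRadial.lintegral_prod_pi`) and Mathlib (polar coordinates for ANY norm `integral_fun_norm_addHaar`, the
Gamma integral `integral_rpow_mul_exp_neg_mul_rpow`, log-convexity of `Γ` `Gamma_mul_add_mul_le_rpow_Gamma_mul_rpow_Gamma`);
nothing is cited as a fact; no number beyond the closed forms.  SETTING: `E` a nontrivial finite-dimensional real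
normed space of dimension `d` (ANY norm — the radial ratios below do not depend on it), `μ` an additive Haar measure
on `E`, `κ > 0`, the kinetic term `T(p) = κΣ_l‖p_l‖²` on `L → E` (for an inner product norm `= κΣ_l⟪p_l,p_l⟫`, the
`B`-kinetic term of `SUNLeapfrogEnergyError` with `B = ⟪·,·⟫`; `E = ℝ³`: `su2Kinetic κ`, `sunMomentumLaw_pauli`).

* §1 (one link) **`integral_norm_pow_mul_exp_neg_mul_sq_norm_addHaar`** —
  `∫ ‖v‖^k e^{−κ‖v‖²} dμ = d·μ(B₁)·(κ^{−(k+d)/2}·½·Γ((k+d)/2))` for every `k : ℕ` (polar coordinates + Gamma);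
  `integrable_norm_pow_mul_exp_neg_mul_sq_norm_addHaar`; `integral_exp_neg_mul_sq_norm_addHaar_pos`;
  **`integral_norm_sq_mul_exp_neg_mul_sq_norm_addHaar`** — `∫ ‖v‖² e^{−κ‖v‖²} = (d/(2κ))·∫ e^{−κ‖v‖²}`
  (`Γ(d/2 + 1) = (d/2)Γ(d/2)`); `Gamma_half_add_half_le` (`Γ((d+1)/2) ≤ √(d/2)·Γ(d/2)`, log-convexity);
  **`integral_norm_mul_exp_neg_mul_sq_norm_addHaar_le`** — `∫ ‖v‖ e^{−κ‖v‖²} ≤ √(d/(2κ))·∫ e^{−κ‖v‖²}`.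
* §2 (the product law on `E^L`) `sunMomentumWeight_normSq_univ` (`Z = (∫ e^{−κ‖v‖²}dμ)^{|L|}`, Tonelli),
  `sunMomentumWeight_normSq_univ_ne_top`, `isProbabilityMeasure_sunMomentumLaw_normSq`;
  **`lintegral_norm_apply_pow_sunMomentumWeight`** — `∫ ‖p_l‖^k e^{−T} = (∫ ‖v‖^k e^{−κ‖v‖²})·(∫ e^{−κ‖v‖²})^{|L|−1}`;
  **`integral_norm_apply_pow_sunMomentumLaw`** — `E ‖p_l‖^k = (∫ ‖v‖^k e^{−κ‖v‖²})/(∫ e^{−κ‖v‖²})`;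
  `integrable_norm_apply_pow_sunMomentumLaw`; **`integral_norm_apply_sq_sunMomentumLaw`** (`E‖p_l‖² = d/(2κ)`),
  **`integral_norm_apply_sunMomentumLaw_le`** (`E‖p_l‖ ≤ √(d/(2κ))`), **`integral_sum_norm_sunMomentumLaw_le`**
  (`E Σ_l‖p_l‖ ≤ |L|·√(d/(2κ))`), **`integral_sq_sum_norm_sunMomentumLaw_le`** (`E (Σ_l‖p_l‖)² ≤ |L|²·d/(2κ)`,
  Cauchy–Schwarz over the links).

NOT CLAIMED: the exact first moment `Γ((d+1)/2)/(Γ(d/2)√κ)` in closed elementary form; higher moments; the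
engine's coordinates `sunCoordι` / `sunKinetic` (a quadratic form that is not the square of the sup norm carried by
`SUNCoords N` — a dictionary, not re-derived here); anything about the configuration marginal; any number beyond
these closed forms.
-/

noncomputable section

namespace Summit.Ventures.LatticeQCDFlow.Exactness

open Set MeasureTheory Metric
open scoped ENNReal

/-! ## §1 Radial Gaussian moments on a `d`-dimensional normed space -/

section OneLink

variable {E : Type*} [NormedAddCommGroup E] [NormedSpace ℝ E] [FiniteDimensional ℝ E] [Nontrivial E]
  [MeasurableSpace E] [BorelSpace E] (μ : Measure E) [μ.IsAddHaarMeasure]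

/-- **`∫ ‖v‖^k e^{−κ‖v‖²} dμ = d·μ(B₁)·(κ^{−(k+d)/2}·½·Γ((k+d)/2))`** (polar coordinates for the norm of `E` + the
Gamma integral; `d = dim E ≥ 1`). -/
theorem integral_norm_pow_mul_exp_neg_mul_sq_norm_addHaar {κ : ℝ} (hκ : 0 < κ) (k : ℕ) :
    ∫ v, ‖v‖ ^ k * Real.exp (-κ * ‖v‖ ^ 2) ∂μ =
      Module.finrank ℝ E * μ.real (ball 0 1) *
        (κ ^ (-((k : ℝ) + Module.finrank ℝ E) / 2) * (1 / 2) * Real.Gamma (((k : ℝ) + Module.finrank ℝ E) / 2)) := by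
  have hd : 1 ≤ Module.finrank ℝ E := Module.finrank_pos
  have hd1 : (((Module.finrank ℝ E - 1 : ℕ) : ℝ)) = (Module.finrank ℝ E : ℝ) - 1 := by
    rw [Nat.cast_sub hd, Nat.cast_one]
  have h := integral_fun_norm_addHaar μ (fun y : ℝ => y ^ k * Real.exp (-κ * y ^ 2))
  rw [h, nsmul_eq_mul, smul_eq_mul]
  have hI : ∫ y in Ioi (0 : ℝ), y ^ (Module.finrank ℝ E - 1) • (y ^ k * Real.exp (-κ * y ^ 2)) =
      κ ^ (-((k : ℝ) + Module.finrank ℝ E) / 2) * (1 / 2) * Real.Gamma (((k : ℝ) + Module.finrank ℝ E) / 2) := by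
    have hG := integral_rpow_mul_exp_neg_mul_rpow (p := 2) (q := (k : ℝ) + Module.finrank ℝ E - 1) two_pos
      (by have h1 := (Nat.cast_nonneg k : (0 : ℝ) ≤ k); have h2 : (1 : ℝ) ≤ Module.finrank ℝ E := (by exact_mod_cast hd); linarith) hκ
    have e1 : (k : ℝ) + Module.finrank ℝ E - 1 + 1 = (k : ℝ) + Module.finrank ℝ E := by ring
    rw [e1] at hG
    rw [← hG]
    refine setIntegral_congr_fun measurableSet_Ioi fun y hy => ?_
    have hy' : (0 : ℝ) ≤ y := le_of_lt hy
    simp only [smul_eq_mul]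
    rw [show ((k : ℝ) + Module.finrank ℝ E - 1) = ((k + (Module.finrank ℝ E - 1) : ℕ) : ℝ) by push_cast [hd1]; ring,
      Real.rpow_natCast, show (2 : ℝ) = ((2 : ℕ) : ℝ) by norm_num, Real.rpow_natCast]
    ring
  rw [hI]
  ring

/-- `v ↦ ‖v‖^k e^{−κ‖v‖²}` is `μ`-integrable (polar coordinates). -/
theorem integrable_norm_pow_mul_exp_neg_mul_sq_norm_addHaar {κ : ℝ} (hκ : 0 < κ) (k : ℕ) :
    Integrable (fun v : E => ‖v‖ ^ k * Real.exp (-κ * ‖v‖ ^ 2)) μ := by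
  have hd : 1 ≤ Module.finrank ℝ E := Module.finrank_pos
  have hd1 : (((Module.finrank ℝ E - 1 : ℕ) : ℝ)) = (Module.finrank ℝ E : ℝ) - 1 := by
    rw [Nat.cast_sub hd, Nat.cast_one]
  have h := (integrable_fun_norm_addHaar μ (f := fun y : ℝ => y ^ k * Real.exp (-κ * y ^ 2))).2
  refine h ?_
  have hI := integrableOn_rpow_mul_exp_neg_mul_sq hκ (s := (k : ℝ) + Module.finrank ℝ E - 1)
    (by have h1 := (Nat.cast_nonneg k : (0 : ℝ) ≤ k); have h2 : (1 : ℝ) ≤ Module.finrank ℝ E := (by exact_mod_cast hd); linarith)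
  refine (integrableOn_congr_fun (fun y hy => ?_) measurableSet_Ioi).1 hI
  have hy' : (0 : ℝ) ≤ y := le_of_lt hy
  simp only [smul_eq_mul]
  rw [show ((k : ℝ) + Module.finrank ℝ E - 1) = ((k + (Module.finrank ℝ E - 1) : ℕ) : ℝ) by push_cast [hd1]; ring,
    Real.rpow_natCast]
  ring

/-- `∫ e^{−κ‖v‖²} dμ > 0`. -/
theorem integral_exp_neg_mul_sq_norm_addHaar_pos {κ : ℝ} (hκ : 0 < κ) :
    0 < ∫ v, Real.exp (-κ * ‖v‖ ^ 2) ∂μ := by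
  have h := integral_norm_pow_mul_exp_neg_mul_sq_norm_addHaar μ hκ 0
  simp only [pow_zero, one_mul, Nat.cast_zero, zero_add] at h
  rw [h]
  have hd : (0 : ℝ) < Module.finrank ℝ E := by exact_mod_cast (Module.finrank_pos : 0 < Module.finrank ℝ E)
  have hB : 0 < μ.real (ball (0 : E) 1) :=
    ENNReal.toReal_pos (measure_ball_pos μ 0 one_pos).ne' measure_ball_lt_top.ne
  have hG : 0 < Real.Gamma ((Module.finrank ℝ E : ℝ) / 2) := Real.Gamma_pos_of_pos (by positivity)
  have hr : 0 < κ ^ (-(Module.finrank ℝ E : ℝ) / 2) := Real.rpow_pos_of_pos hκ _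
  positivity

/-- **The second radial moment: `∫ ‖v‖² e^{−κ‖v‖²} = (d/(2κ)) ∫ e^{−κ‖v‖²}`** (`Γ(d/2 + 1) = (d/2)Γ(d/2)`). -/
theorem integral_norm_sq_mul_exp_neg_mul_sq_norm_addHaar {κ : ℝ} (hκ : 0 < κ) :
    ∫ v, ‖v‖ ^ 2 * Real.exp (-κ * ‖v‖ ^ 2) ∂μ =
      Module.finrank ℝ E / (2 * κ) * ∫ v, Real.exp (-κ * ‖v‖ ^ 2) ∂μ := by
  have h0 := integral_norm_pow_mul_exp_neg_mul_sq_norm_addHaar μ hκ 0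
  simp only [pow_zero, one_mul, Nat.cast_zero, zero_add] at h0
  rw [integral_norm_pow_mul_exp_neg_mul_sq_norm_addHaar μ hκ 2, h0]
  have hd : (0 : ℝ) < Module.finrank ℝ E := by exact_mod_cast (Module.finrank_pos : 0 < Module.finrank ℝ E)
  have h5 : Real.Gamma ((((2 : ℕ) : ℝ) + Module.finrank ℝ E) / 2) = Module.finrank ℝ E / 2 * Real.Gamma ((Module.finrank ℝ E : ℝ) / 2) := by
    rw [show (((2 : ℕ) : ℝ) + Module.finrank ℝ E) / 2 = (Module.finrank ℝ E : ℝ) / 2 + 1 by push_cast; ring]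
    exact Real.Gamma_add_one (by positivity)
  have hk : κ ^ (-(((2 : ℕ) : ℝ) + Module.finrank ℝ E) / 2) = κ ^ (-(Module.finrank ℝ E : ℝ) / 2) * κ⁻¹ := by
    rw [show (-(((2 : ℕ) : ℝ) + Module.finrank ℝ E) / 2) = (-(Module.finrank ℝ E : ℝ) / 2) + (-1) by push_cast; ring,
      Real.rpow_add hκ, Real.rpow_neg_one]
  rw [h5, hk]
  field_simp

/-- Log-convexity of `Γ` between `d/2` and `d/2 + 1`: **`Γ((d+1)/2) ≤ √(d/2)·Γ(d/2)`** for `d > 0`. -/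
theorem Gamma_half_add_half_le {d : ℝ} (hd : 0 < d) :
    Real.Gamma ((d + 1) / 2) ≤ Real.sqrt (d / 2) * Real.Gamma (d / 2) := by
  have hs : 0 < d / 2 := by positivity
  have ht : 0 < d / 2 + 1 := by positivity
  have h := Real.Gamma_mul_add_mul_le_rpow_Gamma_mul_rpow_Gamma (s := d / 2) (t := d / 2 + 1) (a := 1 / 2) (b := 1 / 2)
    hs ht (by norm_num) (by norm_num) (by norm_num)
  have hG0 : 0 ≤ Real.Gamma (d / 2) := (Real.Gamma_pos_of_pos hs).le
  rw [show 1 / 2 * (d / 2) + 1 / 2 * (d / 2 + 1) = (d + 1) / 2 by ring, Real.Gamma_add_one hs.ne',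
    ← Real.sqrt_eq_rpow, ← Real.sqrt_eq_rpow, ← Real.sqrt_mul hG0,
    show Real.Gamma (d / 2) * (d / 2 * Real.Gamma (d / 2)) = (d / 2) * (Real.Gamma (d / 2) * Real.Gamma (d / 2)) by ring,
    Real.sqrt_mul hs.le, Real.sqrt_mul_self hG0] at h
  exact h

/-- **The first radial moment is at most `√(d/(2κ))` times the mass**:
`∫ ‖v‖ e^{−κ‖v‖²} ≤ √(d/(2κ))·∫ e^{−κ‖v‖²}` (`Γ((d+1)/2) ≤ √(d/2)Γ(d/2)`). -/
theorem integral_norm_mul_exp_neg_mul_sq_norm_addHaar_le {κ : ℝ} (hκ : 0 < κ) :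
    ∫ v, ‖v‖ * Real.exp (-κ * ‖v‖ ^ 2) ∂μ ≤
      Real.sqrt (Module.finrank ℝ E / (2 * κ)) * ∫ v, Real.exp (-κ * ‖v‖ ^ 2) ∂μ := by
  have h0 := integral_norm_pow_mul_exp_neg_mul_sq_norm_addHaar μ hκ 0
  simp only [pow_zero, one_mul, Nat.cast_zero, zero_add] at h0
  have h1 := integral_norm_pow_mul_exp_neg_mul_sq_norm_addHaar μ hκ 1
  simp only [pow_one, Nat.cast_one] at h1
  rw [h1, h0]
  have hd : (0 : ℝ) < Module.finrank ℝ E := by exact_mod_cast (Module.finrank_pos : 0 < Module.finrank ℝ E)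
  have hB : 0 ≤ μ.real (ball (0 : E) 1) := measureReal_nonneg
  have hG := Gamma_half_add_half_le hd
  have hk : κ ^ (-((1 : ℝ) + Module.finrank ℝ E) / 2) = κ ^ (-(Module.finrank ℝ E : ℝ) / 2) * (Real.sqrt κ)⁻¹ := by
    rw [show (-((1 : ℝ) + Module.finrank ℝ E) / 2) = (-(Module.finrank ℝ E : ℝ) / 2) + (-(1 / 2)) by ring, Real.rpow_add hκ,
      Real.rpow_neg hκ.le, Real.sqrt_eq_rpow]
  have hsq : Real.sqrt (Module.finrank ℝ E / (2 * κ)) = Real.sqrt (Module.finrank ℝ E / 2) * (Real.sqrt κ)⁻¹ := by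
    rw [show (Module.finrank ℝ E : ℝ) / (2 * κ) = (Module.finrank ℝ E / 2) / κ by ring, Real.sqrt_div' _ hκ.le, div_eq_mul_inv]
  have hr : 0 ≤ κ ^ (-(Module.finrank ℝ E : ℝ) / 2) := (Real.rpow_pos_of_pos hκ _).le
  have hsk : 0 ≤ (Real.sqrt κ)⁻¹ := inv_nonneg.2 (Real.sqrt_nonneg κ)
  rw [hk, hsq, show ((1 : ℝ) + Module.finrank ℝ E) / 2 = ((Module.finrank ℝ E : ℝ) + 1) / 2 by ring]
  calc Module.finrank ℝ E * μ.real (ball (0 : E) 1) *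
        (κ ^ (-(Module.finrank ℝ E : ℝ) / 2) * (Real.sqrt κ)⁻¹ * (1 / 2) * Real.Gamma (((Module.finrank ℝ E : ℝ) + 1) / 2))
      ≤ Module.finrank ℝ E * μ.real (ball (0 : E) 1) *
        (κ ^ (-(Module.finrank ℝ E : ℝ) / 2) * (Real.sqrt κ)⁻¹ * (1 / 2) *
          (Real.sqrt (Module.finrank ℝ E / 2) * Real.Gamma ((Module.finrank ℝ E : ℝ) / 2))) := by gcongr
    _ = Real.sqrt (Module.finrank ℝ E / 2) * (Real.sqrt κ)⁻¹ *
        (Module.finrank ℝ E * μ.real (ball (0 : E) 1) * (κ ^ (-(Module.finrank ℝ E : ℝ) / 2) * (1 / 2) * Real.Gamma ((Module.finrank ℝ E : ℝ) / 2))) := by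
        ring

end OneLink

/-! ## §2 The product law with kinetic term `κΣ_l‖p_l‖²` on `E^L`: mass, one-link moments, `E Σ_l‖p_l‖`, `E (Σ_l‖p_l‖)²` -/

section Product

variable {E : Type*} [NormedAddCommGroup E] [NormedSpace ℝ E] [FiniteDimensional ℝ E] [Nontrivial E]
  [MeasurableSpace E] [BorelSpace E] (μ : Measure E) [μ.IsAddHaarMeasure]
variable {L : Type*} [Fintype L]

omit [NormedSpace ℝ E] [FiniteDimensional ℝ E] [Nontrivial E] [BorelSpace E] [μ.IsAddHaarMeasure] in
/-- The kinetic term `κΣ_l‖p_l‖²` is measurable. -/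
theorem measurable_normSqKinetic [OpensMeasurableSpace E] [SecondCountableTopology E] (κ : ℝ) :
    Measurable fun p : L → E => κ * ∑ l, ‖p l‖ ^ 2 :=
  measurable_const.mul (Finset.measurable_sum _ fun l _ => (measurable_pi_apply l).norm.pow_const 2)

/-- **Tonelli over the links for a one-link observable**:
`∫ ‖p_l‖^k e^{−T(p)} dμ^{⊗L} = (∫ ‖v‖^k e^{−κ‖v‖²}dμ)·(∫ e^{−κ‖v‖²}dμ)^{|L|−1}`. -/
theorem lintegral_norm_apply_pow_sunMomentumWeight {κ : ℝ} (hκ : 0 < κ) (k : ℕ) (l : L) :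
    ∫⁻ p, ENNReal.ofReal (‖p l‖ ^ k) ∂(sunMomentumWeight (L := L) μ fun p => κ * ∑ l, ‖p l‖ ^ 2) =
      ENNReal.ofReal (∫ v, ‖v‖ ^ k * Real.exp (-κ * ‖v‖ ^ 2) ∂μ) *
        ENNReal.ofReal (∫ v, Real.exp (-κ * ‖v‖ ^ 2) ∂μ) ^ (Fintype.card L - 1) := by
  classical
  have hmw : Measurable fun v : E => ENNReal.ofReal (Real.exp (-κ * ‖v‖ ^ 2)) :=
    (Real.measurable_exp.comp (measurable_const.mul (measurable_norm.pow_const 2))).ennreal_ofReal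
  have hmk : Measurable fun v : E => ENNReal.ofReal (‖v‖ ^ k * Real.exp (-κ * ‖v‖ ^ 2)) :=
    ((measurable_norm.pow_const k).mul (Real.measurable_exp.comp (measurable_const.mul (measurable_norm.pow_const 2)))).ennreal_ofReal
  -- the factorised integrand
  set F : L → E → ℝ≥0∞ := fun m v =>
    if m = l then ENNReal.ofReal (‖v‖ ^ k * Real.exp (-κ * ‖v‖ ^ 2)) else ENNReal.ofReal (Real.exp (-κ * ‖v‖ ^ 2)) with hF
  have hFm : ∀ m, Measurable (F m) := by
    intro m
    by_cases hm : m = l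
    · simp only [hF, hm, if_true]; exact hmk
    · simp only [hF, hm, if_false]; exact hmw
  have hdens : ∀ p : L → E,
      ENNReal.ofReal (Real.exp (-(κ * ∑ l, ‖p l‖ ^ 2))) * ENNReal.ofReal (‖p l‖ ^ k) = ∏ m, F m (p m) := by
    intro p
    have h1 : ENNReal.ofReal (Real.exp (-(κ * ∑ l, ‖p l‖ ^ 2))) = ∏ m, ENNReal.ofReal (Real.exp (-κ * ‖p m‖ ^ 2)) := by
      rw [← ENNReal.ofReal_prod_of_nonneg (fun m _ => (Real.exp_pos _).le), ← Real.exp_sum]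
      congr 2
      rw [Finset.mul_sum Finset.univ (fun m => ‖p m‖ ^ 2) κ, ← Finset.sum_neg_distrib]
      exact Finset.sum_congr rfl fun m _ => by ring
    rw [h1, ← Finset.mul_prod_erase Finset.univ (fun m => ENNReal.ofReal (Real.exp (-κ * ‖p m‖ ^ 2))) (Finset.mem_univ l),
      ← Finset.mul_prod_erase Finset.univ (fun m => F m (p m)) (Finset.mem_univ l)]
    have hl : F l (p l) = ENNReal.ofReal (‖p l‖ ^ k * Real.exp (-κ * ‖p l‖ ^ 2)) := by simp only [hF, if_true]
    have hrest : ∏ m ∈ Finset.univ.erase l, F m (p m) = ∏ m ∈ Finset.univ.erase l, ENNReal.ofReal (Real.exp (-κ * ‖p m‖ ^ 2)) := by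
      refine Finset.prod_congr rfl fun m hm => ?_
      have hml : m ≠ l := Finset.ne_of_mem_erase hm
      simp only [hF, hml, if_false]
    rw [hl, hrest, ENNReal.ofReal_mul (pow_nonneg (norm_nonneg _) k)]
    ring
  have hmd : Measurable (fun p : L → E => ENNReal.ofReal (Real.exp (-(κ * ∑ l, ‖p l‖ ^ 2)))) :=
    (Real.measurable_exp.comp (measurable_normSqKinetic κ).neg).ennreal_ofReal
  rw [sunMomentumWeight, lintegral_withDensity_eq_lintegral_mul _ hmd ((measurable_pi_apply l).norm.pow_const k).ennreal_ofReal]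
  simp only [Pi.mul_apply]
  simp_rw [hdens]
  rw [lintegral_prod_pi (fun _ : L => μ) hFm, ← Finset.mul_prod_erase Finset.univ (fun m => ∫⁻ v, F m v ∂μ) (Finset.mem_univ l)]
  have hl : ∫⁻ v, F l v ∂μ = ENNReal.ofReal (∫ v, ‖v‖ ^ k * Real.exp (-κ * ‖v‖ ^ 2) ∂μ) := by
    simp only [hF, if_true]
    rw [← ofReal_integral_eq_lintegral_ofReal (integrable_norm_pow_mul_exp_neg_mul_sq_norm_addHaar μ hκ k)
      (Filter.Eventually.of_forall fun v => by positivity)]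
  have hrest : ∏ m ∈ Finset.univ.erase l, ∫⁻ v, F m v ∂μ =
      ENNReal.ofReal (∫ v, Real.exp (-κ * ‖v‖ ^ 2) ∂μ) ^ (Fintype.card L - 1) := by
    rw [← Finset.card_univ, ← Finset.card_erase_of_mem (Finset.mem_univ l), ← Finset.prod_const]
    refine Finset.prod_congr rfl fun m hm => ?_
    have hml : m ≠ l := Finset.ne_of_mem_erase hm
    simp only [hF, hml, if_false]
    have hi := integrable_norm_pow_mul_exp_neg_mul_sq_norm_addHaar μ hκ 0
    simp only [pow_zero, one_mul] at hi
    rw [← ofReal_integral_eq_lintegral_ofReal hi (Filter.Eventually.of_forall fun v => (Real.exp_pos _).le)]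
  rw [hl, hrest]

/-- **The mass of the momentum weight**: `Z = (∫ e^{−κ‖v‖²}dμ)^{|L|}` (Tonelli). -/
theorem sunMomentumWeight_normSq_univ {κ : ℝ} (hκ : 0 < κ) :
    sunMomentumWeight (L := L) μ (fun p => κ * ∑ l, ‖p l‖ ^ 2) univ =
      ENNReal.ofReal (∫ v, Real.exp (-κ * ‖v‖ ^ 2) ∂μ) ^ Fintype.card L := by
  have hmeas1 : Measurable fun v : E => ENNReal.ofReal (Real.exp (-κ * ‖v‖ ^ 2)) :=
    (Real.measurable_exp.comp (measurable_const.mul (measurable_norm.pow_const 2))).ennreal_ofReal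
  have h1 : ∀ p : L → E, ENNReal.ofReal (Real.exp (-(κ * ∑ l, ‖p l‖ ^ 2))) =
      ∏ l, ENNReal.ofReal (Real.exp (-κ * ‖p l‖ ^ 2)) := fun p => by
    rw [← ENNReal.ofReal_prod_of_nonneg (fun l _ => (Real.exp_pos _).le), ← Real.exp_sum]
    congr 2
    rw [Finset.mul_sum Finset.univ (fun m => ‖p m‖ ^ 2) κ, ← Finset.sum_neg_distrib]
    exact Finset.sum_congr rfl fun m _ => by ring
  rw [sunMomentumWeight, withDensity_apply _ MeasurableSet.univ, Measure.restrict_univ]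
  simp_rw [h1]
  rw [lintegral_prod_pi (fun _ : L => μ) (fun _ => hmeas1), Finset.prod_const, Finset.card_univ]
  have hi := integrable_norm_pow_mul_exp_neg_mul_sq_norm_addHaar μ hκ 0
  simp only [pow_zero, one_mul] at hi
  rw [← ofReal_integral_eq_lintegral_ofReal hi (Filter.Eventually.of_forall fun v => (Real.exp_pos _).le)]

/-- `Z < ∞`. -/
theorem sunMomentumWeight_normSq_univ_ne_top {κ : ℝ} (hκ : 0 < κ) :
    sunMomentumWeight (L := L) μ (fun p => κ * ∑ l, ‖p l‖ ^ 2) univ ≠ ⊤ := by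
  rw [sunMomentumWeight_normSq_univ μ hκ]
  exact ENNReal.pow_ne_top ENNReal.ofReal_ne_top

/-- The refresh law with kinetic term `κΣ_l‖p_l‖²` is a probability law. -/
theorem isProbabilityMeasure_sunMomentumLaw_normSq {κ : ℝ} (hκ : 0 < κ) :
    IsProbabilityMeasure (sunMomentumLaw (L := L) μ fun p => κ * ∑ l, ‖p l‖ ^ 2) :=
  isProbabilityMeasure_sunMomentumLaw μ _ (measurable_normSqKinetic κ) (sunMomentumWeight_normSq_univ_ne_top μ hκ)

/-- **THE ONE-LINK MOMENTS OF THE MOMENTUM LAW ARE THE RADIAL GAUSSIAN RATIOS**: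
`E ‖p_l‖^k = (∫ ‖v‖^k e^{−κ‖v‖²}dμ) / (∫ e^{−κ‖v‖²}dμ)`. -/
theorem integral_norm_apply_pow_sunMomentumLaw {κ : ℝ} (hκ : 0 < κ) (k : ℕ) (l : L) :
    ∫ p, ‖p l‖ ^ k ∂(sunMomentumLaw (L := L) μ fun p => κ * ∑ l, ‖p l‖ ^ 2) =
      (∫ v, ‖v‖ ^ k * Real.exp (-κ * ‖v‖ ^ 2) ∂μ) / ∫ v, Real.exp (-κ * ‖v‖ ^ 2) ∂μ := by
  have hJ0 := integral_exp_neg_mul_sq_norm_addHaar_pos μ hκ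
  have hJk : 0 ≤ ∫ v, ‖v‖ ^ k * Real.exp (-κ * ‖v‖ ^ 2) ∂μ := integral_nonneg fun v => by positivity
  have hmeas : Measurable fun p : L → E => ‖p l‖ ^ k := (measurable_pi_apply l).norm.pow_const k
  rw [integral_eq_lintegral_of_nonneg_ae (Filter.Eventually.of_forall fun p => by positivity) hmeas.aestronglyMeasurable,
    sunMomentumLaw, lintegral_smul_measure, lintegral_norm_apply_pow_sunMomentumWeight μ hκ k l,
    sunMomentumWeight_normSq_univ μ hκ, smul_eq_mul]
  rw [ENNReal.toReal_mul, ENNReal.toReal_mul, ENNReal.toReal_inv, ENNReal.toReal_pow, ENNReal.toReal_pow,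
    ENNReal.toReal_ofReal hJk, ENNReal.toReal_ofReal hJ0.le]
  set A := ∫ v, Real.exp (-κ * ‖v‖ ^ 2) ∂μ with hA
  set J := ∫ v, ‖v‖ ^ k * Real.exp (-κ * ‖v‖ ^ 2) ∂μ with hJ
  have hc : Fintype.card L = (Fintype.card L - 1) + 1 :=
    (Nat.succ_pred_eq_of_pos (Fintype.card_pos_iff.2 ⟨l⟩)).symm
  have hAne : A ≠ 0 := hJ0.ne'
  have hAc : A ^ (Fintype.card L - 1) ≠ 0 := pow_ne_zero _ hAne
  rw [hc, pow_succ, Nat.add_sub_cancel]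
  field_simp

/-- The one-link observables `‖p_l‖^k` are integrable under the momentum law. -/
theorem integrable_norm_apply_pow_sunMomentumLaw {κ : ℝ} (hκ : 0 < κ) (k : ℕ) (l : L) :
    Integrable (fun p : L → E => ‖p l‖ ^ k) (sunMomentumLaw (L := L) μ fun p => κ * ∑ l, ‖p l‖ ^ 2) := by
  have hmeas : Measurable fun p : L → E => ‖p l‖ ^ k := (measurable_pi_apply l).norm.pow_const k
  refine ⟨hmeas.aestronglyMeasurable, (hasFiniteIntegral_iff_ofReal (Filter.Eventually.of_forall fun p => by positivity)).2 ?_⟩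
  rw [sunMomentumLaw, lintegral_smul_measure, lintegral_norm_apply_pow_sunMomentumWeight μ hκ k l, smul_eq_mul]
  refine ENNReal.mul_lt_top ?_ ?_
  · exact ENNReal.inv_lt_top.2 (pos_iff_ne_zero.2 (sunMomentumWeight_univ_ne_zero μ _ (measurable_normSqKinetic κ)))
  · exact ENNReal.mul_lt_top ENNReal.ofReal_lt_top (ENNReal.pow_lt_top ENNReal.ofReal_lt_top)

/-- **`E ‖p_l‖² = d/(2κ)`** under the refresh law (each `p_l` has density `∝ e^{−κ‖p_l‖²}dμ`). -/
theorem integral_norm_apply_sq_sunMomentumLaw {κ : ℝ} (hκ : 0 < κ) (l : L) :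
    ∫ p, ‖p l‖ ^ 2 ∂(sunMomentumLaw (L := L) μ fun p => κ * ∑ l, ‖p l‖ ^ 2) = Module.finrank ℝ E / (2 * κ) := by
  rw [integral_norm_apply_pow_sunMomentumLaw μ hκ 2 l, integral_norm_sq_mul_exp_neg_mul_sq_norm_addHaar μ hκ,
    mul_div_assoc, div_self (integral_exp_neg_mul_sq_norm_addHaar_pos μ hκ).ne', mul_one]

/-- **`E ‖p_l‖ ≤ √(d/(2κ))`** under the refresh law. -/
theorem integral_norm_apply_sunMomentumLaw_le {κ : ℝ} (hκ : 0 < κ) (l : L) :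
    ∫ p, ‖p l‖ ∂(sunMomentumLaw (L := L) μ fun p => κ * ∑ l, ‖p l‖ ^ 2) ≤ Real.sqrt (Module.finrank ℝ E / (2 * κ)) := by
  have h := integral_norm_apply_pow_sunMomentumLaw (L := L) μ hκ 1 l
  simp only [pow_one] at h
  rw [h, div_le_iff₀ (integral_exp_neg_mul_sq_norm_addHaar_pos μ hκ)]
  exact integral_norm_mul_exp_neg_mul_sq_norm_addHaar_le μ hκ

/-- **`E Σ_l ‖p_l‖ ≤ |L|·√(d/(2κ))`**. -/
theorem integral_sum_norm_sunMomentumLaw_le {κ : ℝ} (hκ : 0 < κ) :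
    ∫ p, ∑ l, ‖p l‖ ∂(sunMomentumLaw (L := L) μ fun p => κ * ∑ l, ‖p l‖ ^ 2) ≤
      Fintype.card L * Real.sqrt (Module.finrank ℝ E / (2 * κ)) := by
  rw [integral_finsetSum _ fun l _ => by simpa only [pow_one] using integrable_norm_apply_pow_sunMomentumLaw (L := L) μ hκ 1 l]
  calc ∑ l, ∫ p, ‖p l‖ ∂(sunMomentumLaw (L := L) μ fun p => κ * ∑ l, ‖p l‖ ^ 2)
      ≤ ∑ _l : L, Real.sqrt (Module.finrank ℝ E / (2 * κ)) := Finset.sum_le_sum fun l _ => integral_norm_apply_sunMomentumLaw_le μ hκ l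
    _ = Fintype.card L * Real.sqrt (Module.finrank ℝ E / (2 * κ)) := by
        rw [Finset.sum_const, Finset.card_univ, nsmul_eq_mul]

/-- **`E (Σ_l ‖p_l‖)² ≤ |L|²·d/(2κ)`** (Cauchy–Schwarz over the links). -/
theorem integral_sq_sum_norm_sunMomentumLaw_le {κ : ℝ} (hκ : 0 < κ) :
    ∫ p, (∑ l, ‖p l‖) ^ 2 ∂(sunMomentumLaw (L := L) μ fun p => κ * ∑ l, ‖p l‖ ^ 2) ≤
      (Fintype.card L : ℝ) ^ 2 * (Module.finrank ℝ E / (2 * κ)) := by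
  haveI := isProbabilityMeasure_sunMomentumLaw_normSq (L := L) μ hκ
  have hint2 : Integrable (fun p : L → E => (Fintype.card L : ℝ) * ∑ l, ‖p l‖ ^ 2)
      (sunMomentumLaw (L := L) μ fun p => κ * ∑ l, ‖p l‖ ^ 2) :=
    (integrable_finsetSum _ fun l _ => integrable_norm_apply_pow_sunMomentumLaw (L := L) μ hκ 2 l).const_mul _
  have hle : ∀ p : L → E, (∑ l, ‖p l‖) ^ 2 ≤ (Fintype.card L : ℝ) * ∑ l, ‖p l‖ ^ 2 := by
    intro p
    have h := sq_sum_le_card_mul_sum_sq (s := Finset.univ) (f := fun l => ‖p l‖)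
    simpa only [Finset.card_univ] using h
  have hmeas : Measurable fun p : L → E => (∑ l, ‖p l‖) ^ 2 :=
    (Finset.measurable_sum _ fun l _ => (measurable_pi_apply l).norm).pow_const 2
  have hint1 : Integrable (fun p : L → E => (∑ l, ‖p l‖) ^ 2) (sunMomentumLaw (L := L) μ fun p => κ * ∑ l, ‖p l‖ ^ 2) :=
    hint2.mono' hmeas.aestronglyMeasurable (Filter.Eventually.of_forall fun p => by
      rw [Real.norm_eq_abs, abs_of_nonneg (sq_nonneg _)]; exact hle p)
  calc ∫ p, (∑ l, ‖p l‖) ^ 2 ∂(sunMomentumLaw (L := L) μ fun p => κ * ∑ l, ‖p l‖ ^ 2)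
      ≤ ∫ p, (Fintype.card L : ℝ) * ∑ l, ‖p l‖ ^ 2 ∂(sunMomentumLaw (L := L) μ fun p => κ * ∑ l, ‖p l‖ ^ 2) :=
        integral_mono hint1 hint2 hle
    _ = (Fintype.card L : ℝ) ^ 2 * (Module.finrank ℝ E / (2 * κ)) := by
        rw [integral_const_mul, integral_finsetSum _ fun l _ => integrable_norm_apply_pow_sunMomentumLaw (L := L) μ hκ 2 l]
        simp only [integral_norm_apply_sq_sunMomentumLaw μ hκ, Finset.sum_const, Finset.card_univ, nsmul_eq_mul]
        ring

end Product

end Summit.Ventures.LatticeQCDFlow.Exactness
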